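import Summits.ABC.ABC.Theorems.SomeWindowSaving.Negative.TwistCounting
import Summits.ABC.ABC.Theorems.TwistAmplificationTwistAmplificationLemmaReduced
import Summits.ABC.ABC.Theorems.TwistAmplificationTwistAmplificationLemmaExponents

/-!
# Route TwistAmplification — support item `TwistAmplificationLemma` (stmt-ABC-1978): proof

`twistAmplificationLemma_proof : Summit.ABC.ABC.Theses.TwistAmplification.TwistAmplificationLemma`
(Theorem A of the route card, the cofinite-in-conductor form of twist amplification):
assume `QuadraticTwistInvariants` (route support decl, taken as the hypothesis it is in the
statement) and a window count `T⁺_[κ,σ](X) ≤ C·X^δ` (`X ≥ 1`) with `3 < κ < σ`,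
`δ < (σ−κ)/(2σ−6)`; then for every `σ' > σ` there is `N₀` such that every integral model minimal
at all places with `c₄ c₆ ≠ 0` and conductor `N ≥ N₀` has `max(|Δ|, |c₄|³) ≤ N^{σ'}`.

## Proof (amplification along the prime-twist orbit)

Let `W₀` be a violator: conductor `N ≥ N₀`, size `M := max(|Δ|,|c₄|³) > N^{σ'}`.  Put
`Y := (M/N^κ)^{1/(2κ−6)}`, `Y₁ := (M/N^σ)^{1/(2σ−6)}`, `X := N·Y²`.
* For a prime `p ≥ 5`, `p ∤ N`, one of `d = ±p` is `≡ 1 (mod 4)`, squarefree and coprime to `6N`,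
  so `QuadraticTwistInvariants` gives a minimal integral model of the twist with
  `Δ ↦ d⁶Δ`, `c₄ ↦ d²c₄`, `N ↦ N p²`; an integral translate `(1; r, s, t)` makes it REDUCED
  without changing covariants, minimality or conductor
  (`TwistAmplificationLemma.exists_reduced_model`).  Its size is `p⁶ M`, and
  `(N p²)^κ ≤ p⁶ M ≤ (N p²)^σ` exactly when `Y₁ ≤ p ≤ Y` (`upper_edge`, `lower_edge`); `c₆ ≠ 0`
  by `c₆² = c₄³ − 1728Δ`.  So every prime `p ∈ (Y/8, Y]`, `p ∤ N`, yields a member of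
  `windowSet κ σ X` of conductor `N p²` (`exists_twist_mem_windowSet`), provided `8 Y₁ ≤ Y`, which
  holds as soon as `N^{(σ−κ)/(2κ−6)} ≥ 8` (`separation`, using `M ≥ N^σ`).
* Distinct `p` give distinct conductors, so `#good primes ≤ T⁺_[κ,σ](X) ≤ C X^δ`
  (`windowSet_finite` makes `ncard` honest).
* `#primes(Y/8, Y] ≥ Y/(8 log Y)` for `Y ≥ Y₀` (`prime_supply`, from the tree's PNT bounds), and
  fewer than `E := ⌊2(2κ−6)/(σ'−κ)⌋ + 1` of them divide `N`, because their product divides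
  `N ≤ Y^{(2κ−6)/(σ'−κ)} ≤ (Y/8)^E` (`base_le_rpow_upper`, `rpow_le_div_eight_pow`,
  `card_filter_dvd_lt`).
* `X ≤ Y^ν`, `ν = 2 + (2κ−6)/(σ'−κ) = (2σ'−6)/(σ'−κ)` (`scale_le_rpow_upper`), so
  `C X^δ ≤ C⁺ Y^λ` with `λ = max δ 0 · ν < 1` (`saving_exponent_lt_one`: this is
  `δ < (σ'−κ)/(2σ'−6)`, i.e. the monotonicity of `s ↦ (s−κ)/(2s−6)` for `κ > 3`).
* Hence `Y/(8 log Y) ≤ #primes < #good + E ≤ C⁺ Y^λ + E`, contradicting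
  `(E + C⁺ Y^λ)·8 log Y < Y` for `Y` large (`eventually_count_lt`); and `Y` IS large:
  `Y ≥ N^{(σ'−κ)/(2κ−6)}` (`rpow_le_upper`), so the threshold `N₀` is
  `max((max a 1)^{1/θ}, 8^{(2κ−6)/(σ−κ)}, 1)`, `θ = (σ'−κ)/(2κ−6)`, `a` the eventual bound.

Everything used is proved in the tree: the negative-side support files of crux `SomeWindowSaving`
(`windowSet`, `windowSet_finite`, `prime_supply`, `card_primes_Ioc`, `card_filter_dvd_lt`), the
Literature conductor API (`conductorNorm_pos_holds`, `conductorNorm_smul`,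
`isMinimal_adicCompletion_smul`), and the two helper files of this item
(`…TwistAmplificationLemmaReduced`, `…TwistAmplificationLemmaExponents`).  No named-fact
hypothesis beyond the statement's own `QuadraticTwistInvariants`.
-/

-- `Summit.<Summit>.<Problem>` is the mandated summit-side namespace (CONVENTIONS §2); for the
-- single-conjunct summit `ABC` the two coincide, so the duplicate `ABC.ABC` is deliberate.
set_option linter.dupNamespace false

namespace Summit.ABC.ABC.Theorems

open WeierstrassCurve IsDedekindDomain Real Filter
open Literature.NumberTheory.EllipticCurves
open Summit.ABC.ABC.Theorems.SomeWindowSaving.Negative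
open Summit.ABC.ABC.Theses.TwistAmplification

/-- **Twisting parameters.** For an odd prime `p` one of `±p` is `≡ 1 (mod 4)`: there is a
squarefree `d ≡ 1 (mod 4)` with `|d| = p`. -/
theorem TwistAmplificationLemma.exists_twist_parameter {p : ℕ} (hp : p.Prime) (hp2 : p ≠ 2) :
    ∃ d : ℤ, d.natAbs = p ∧ d ≡ 1 [ZMOD 4] ∧ Squarefree d := by
  rcases hp.eq_two_or_odd' with h | ⟨k, hk⟩
  · exact absurd h hp2
  have hsq : Squarefree (p : ℤ) := (Nat.prime_iff_prime_int.mp hp).squarefree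
  by_cases h4 : p % 4 = 1
  · refine ⟨p, Int.natAbs_natCast p, ?_, hsq⟩
    rw [Int.ModEq]; omega
  · refine ⟨-p, by simp, ?_, ?_⟩
    · rw [Int.ModEq]; omega
    · exact Int.squarefree_natAbs.mp (by simpa using Int.squarefree_natCast.mp hsq)

/-- **One prime twist in the window.** Let `W₀ / ℤ` be a minimal integral model with `c₄ c₆ ≠ 0`,
conductor `N` and size `M = max(|Δ|, |c₄|³)`, and let `p ≥ 5` be a prime not dividing `N` with
`(M/N^σ)^{1/(2σ−6)} ≤ p ≤ (M/N^κ)^{1/(2κ−6)}` and `N p² ≤ X`.  Under `QuadraticTwistInvariants`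
the twist by `d = ±p ≡ 1 (mod 4)` has a REDUCED minimal integral model in the window slice
`windowSet κ σ X`, of conductor `N p²` (its size is `p⁶ M`, and `(N p²)^κ ≤ p⁶ M ≤ (N p²)^σ` by
`upper_edge` / `lower_edge`; `c₆ ≠ 0` by `c₆² = c₄³ − 1728 Δ`). -/
theorem TwistAmplificationLemma.exists_twist_mem_windowSet (hQ : QuadraticTwistInvariants)
    {κ σ X : ℝ} (hκ : 3 < κ) (hσ : 3 < σ) {W₀ : WeierstrassCurve ℤ}
    (hE : (W₀.baseChange ℚ).IsElliptic)
    (hmin : ∀ v : HeightOneSpectrum ℤ, (W₀.baseChange ℚ).IsMinimalAt v)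
    (hc₄ : W₀.c₄ ≠ 0) (hc₆ : W₀.c₆ ≠ 0) {p : ℕ} (hp : p.Prime) (hp5 : 5 ≤ p)
    (hpN : ¬ p ∣ (W₀.baseChange ℚ).conductorNorm ℤ)
    (hpX : (((W₀.baseChange ℚ).conductorNorm ℤ : ℕ) : ℝ) * (p : ℝ) ^ 2 ≤ X)
    (hpY : (p : ℝ) ≤ (((max |W₀.Δ| (|W₀.c₄| ^ 3) : ℤ) : ℝ) /
      (((W₀.baseChange ℚ).conductorNorm ℤ : ℕ) : ℝ) ^ κ) ^ (1 / (2 * κ - 6)))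
    (hpY₁ : (((max |W₀.Δ| (|W₀.c₄| ^ 3) : ℤ) : ℝ) /
      (((W₀.baseChange ℚ).conductorNorm ℤ : ℕ) : ℝ) ^ σ) ^ (1 / (2 * σ - 6)) ≤ p) :
    ∃ W₂ ∈ windowSet κ σ X,
      (W₂.baseChange ℚ).conductorNorm ℤ = (W₀.baseChange ℚ).conductorNorm ℤ * p ^ 2 := by
  haveI := hE
  have hN1 : 1 ≤ (W₀.baseChange ℚ).conductorNorm ℤ := conductorNorm_pos_holds (W₀.baseChange ℚ)
  have hp2 : p ≠ 2 := by omega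
  obtain ⟨d, hdp, hd4, hdsq⟩ := TwistAmplificationLemma.exists_twist_parameter hp hp2
  -- `(d, 6N) = 1`
  have hcop : IsCoprime d (6 * ((W₀.baseChange ℚ).conductorNorm ℤ : ℤ)) := by
    have h6 : Nat.Coprime p (6 * (W₀.baseChange ℚ).conductorNorm ℤ) := by
      refine Nat.Coprime.mul_right ?_ ((Nat.Prime.coprime_iff_not_dvd hp).2 hpN)
      rw [show (6 : ℕ) = 2 * 3 by norm_num]
      exact Nat.Coprime.mul_right ((Nat.coprime_primes hp Nat.prime_two).mpr (by omega))
        ((Nat.coprime_primes hp Nat.prime_three).mpr (by omega))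
    have h6' : IsCoprime (p : ℤ) ((6 * (W₀.baseChange ℚ).conductorNorm ℤ : ℕ) : ℤ) :=
      Nat.isCoprime_iff_coprime.mpr h6
    push_cast at h6'
    rcases Int.natAbs_eq d with h | h <;> rw [h, hdp]
    · exact h6'
    · exact h6'.neg_left
  obtain ⟨W₁, e, -, hmin₁, hΔ₁, hc₄₁, hN₁⟩ := hQ W₀ hE hmin d hdsq hd4 hcop
  -- `W₁` is elliptic
  have hd0 : d ≠ 0 := by
    rintro rfl
    simp only [Int.natAbs_zero] at hdp
    exact hp.ne_zero hdp.symm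
  have hΔ0 : W₀.Δ ≠ 0 := by
    have h := hE.isUnit
    rw [baseChange_int_Δ, isUnit_iff_ne_zero] at h
    exact_mod_cast h
  have hE₁ : (W₁.baseChange ℚ).IsElliptic := by
    refine ⟨?_⟩
    rw [baseChange_int_Δ, hΔ₁, isUnit_iff_ne_zero]
    exact_mod_cast mul_ne_zero (pow_ne_zero 6 hd0) hΔ0
  obtain ⟨W₂, hE₂, hmin₂, ha₁, ha₃, ha₂, hc₄₂, hc₆₂, hΔ₂, hN₂⟩ :=
    TwistAmplificationLemma.exists_reduced_model W₁ hE₁ hmin₁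
  have hN₂' : (W₂.baseChange ℚ).conductorNorm ℤ = (W₀.baseChange ℚ).conductorNorm ℤ * p ^ 2 := by
    rw [hN₂, hN₁, hdp]
  refine ⟨W₂, ?_, hN₂'⟩
  -- covariants of `W₂`
  have hc₄W₂ : W₂.c₄ = d ^ 2 * W₀.c₄ := by rw [hc₄₂, hc₄₁]
  have hΔW₂ : W₂.Δ = d ^ 6 * W₀.Δ := by rw [hΔ₂, hΔ₁]
  have hM₂ : (max |W₂.Δ| (|W₂.c₄| ^ 3) : ℤ) = |d| ^ 6 * max |W₀.Δ| (|W₀.c₄| ^ 3) := by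
    rw [hc₄W₂, hΔW₂, abs_mul, abs_mul, abs_pow, abs_pow, mul_pow, ← pow_mul,
      mul_max_of_nonneg _ _ (by positivity)]
  have hdR : ((|d| : ℤ) : ℝ) = p := by
    rw [Int.abs_eq_natAbs, hdp]; simp
  have hN0 : (0 : ℝ) < (((W₀.baseChange ℚ).conductorNorm ℤ : ℕ) : ℝ) := by exact_mod_cast hN1
  have hM0 : (0 : ℝ) ≤ ((max |W₀.Δ| (|W₀.c₄| ^ 3) : ℤ) : ℝ) := by
    exact_mod_cast (abs_nonneg _).trans (le_max_left _ _)
  have hp0 : (0 : ℝ) < p := by exact_mod_cast hp.pos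
  have e1 : ((((W₀.baseChange ℚ).conductorNorm ℤ * p ^ 2 : ℕ)) : ℝ) =
      (((W₀.baseChange ℚ).conductorNorm ℤ : ℕ) : ℝ) * (p : ℝ) ^ 2 := by push_cast; ring
  have e2 : (((|d| ^ 6 * max |W₀.Δ| (|W₀.c₄| ^ 3) : ℤ)) : ℝ) =
      (p : ℝ) ^ 6 * ((max |W₀.Δ| (|W₀.c₄| ^ 3) : ℤ) : ℝ) := by
    rw [Int.cast_mul, Int.cast_pow, hdR]
  simp only [windowSet, Set.mem_setOf_eq]
  refine ⟨hE₂, hmin₂, ha₁, ha₃, ha₂, ?_, ?_, ?_, ?_, ?_⟩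
  · rw [hc₄W₂]; exact mul_ne_zero (pow_ne_zero 2 hd0) hc₄
  · intro h6
    have hrel₂ := W₂.c_relation
    have hrel₀ := W₀.c_relation
    rw [h6, hc₄W₂, hΔW₂] at hrel₂
    have h : d ^ 6 * W₀.c₆ ^ 2 = 0 := by linear_combination (d ^ 6) * hrel₀ - hrel₂
    rcases mul_eq_zero.mp h with h | h
    · exact pow_ne_zero 6 hd0 h
    · exact hc₆ (pow_eq_zero_iff two_ne_zero |>.mp h)
  · rw [hN₂', e1]; exact hpX
  · rw [hN₂', hM₂, e1, e2]
    exact TwistAmplificationLemma.upper_edge hκ hN0 hM0 hp0 hpY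
  · rw [hN₂', hM₂, e1, e2]
    exact TwistAmplificationLemma.lower_edge hσ hN0 hM0 hp0 hpY₁

/-- **Theorem A of the route (twist amplification), the route decl `TwistAmplificationLemma`.**
Assume `QuadraticTwistInvariants` and a window count `T⁺_[κ,σ](X) ≤ C X^δ` for `X ≥ 1` with
`3 < κ < σ`, `δ < (σ−κ)/(2σ−6)`.  Then for every `σ' > σ` there is `N₀` such that every integral
model minimal at all places with `c₄ c₆ ≠ 0` and conductor `N ≥ N₀` has
`max(|Δ|, |c₄|³) ≤ N^{σ'}`.

Proof.  A violator `W₀` (`M > N^{σ'}`) has, for every prime `p ∤ N` in `(Y/8, Y]`,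
`Y = (M/N^κ)^{1/(2κ−6)}`, a reduced minimal model of its twist by `±p` inside
`windowSet κ σ (N Y²)` (`exists_twist_mem_windowSet`; the lower edge holds because
`8 (M/N^σ)^{1/(2σ−6)} ≤ Y` once `N^{(σ−κ)/(2κ−6)} ≥ 8`, `separation`), and distinct `p` give
distinct conductors `N p²`.  At most `E = O(1)` primes `p > Y/8 ≥ Y^{1/2}` divide
`N ≤ Y^{(2κ−6)/(σ'−κ)}` (`card_filter_dvd_lt`), and `#primes(Y/8, Y] ≥ Y/(8 log Y)`
(`prime_supply`, PNT bounds of the tree).  Hence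
`Y/(8 log Y) − E < T⁺ ≤ C X^δ ≤ C⁺ Y^λ`, `λ = max δ 0 · (2σ'−6)/(σ'−κ) < 1`
(`saving_exponent_lt_one`), impossible for `Y ≥ N^{(σ'−κ)/(2κ−6)}` large
(`eventually_count_lt`). -/
theorem twistAmplificationLemma_proof : TwistAmplificationLemma := by
  intro hQ κ σ δ C hκ hκσ hδ hcount σ' hσσ'
  classical
  have hσ3 : 3 < σ := by linarith
  have hκσ' : κ < σ' := by linarith
  have heκ : (0 : ℝ) < 2 * κ - 6 := by linarith
  -- exponents and constants depending only on `κ σ δ C σ'`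
  set ν : ℝ := (2 * κ - 6) / (σ' - κ) + 2 with hν
  set lam : ℝ := max δ 0 * ν with hlam
  have hν2 : 0 ≤ (2 * κ - 6) / (σ' - κ) := div_nonneg heκ.le (by linarith)
  have hlam1 : lam < 1 := TwistAmplificationLemma.saving_exponent_lt_one hκ hκσ hσσ' hδ
  have hlam0 : 0 ≤ lam := mul_nonneg (le_max_right _ _) (by linarith)
  set E : ℕ := ⌊2 * ((2 * κ - 6) / (σ' - κ))⌋₊ + 1 with hE
  have hE2 : 2 * ((2 * κ - 6) / (σ' - κ)) ≤ E := by
    rw [hE]; push_cast; exact (Nat.lt_floor_add_one _).le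
  set Cp : ℝ := max C 0 with hCp
  obtain ⟨Y₀, hY₀64, hsupply⟩ := prime_supply
  have hev := (TwistAmplificationLemma.eventually_count_lt hlam0 hlam1 (Nat.cast_nonneg E)
    (le_max_right C 0)).and (eventually_ge_atTop Y₀)
  obtain ⟨a, ha⟩ := Filter.eventually_atTop.mp hev
  set θ : ℝ := (σ' - κ) / (2 * κ - 6) with hθ
  have hθ0 : 0 < θ := div_pos (by linarith) heκ
  -- the threshold
  refine ⟨max (max ((max a 1) ^ (1 / θ)) ((8 : ℝ) ^ ((2 * κ - 6) / (σ - κ)))) 1,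
    fun W₀ hEl hmin hc₄ hc₆ hN₀le ↦ ?_⟩
  haveI := hEl
  by_contra hviol
  rw [not_le] at hviol
  set Nn : ℕ := (W₀.baseChange ℚ).conductorNorm ℤ with hNn
  set N : ℝ := (Nn : ℝ) with hNdef
  set M : ℝ := ((max |W₀.Δ| (|W₀.c₄| ^ 3) : ℤ) : ℝ) with hMdef
  have hNnpos : 0 < Nn := conductorNorm_pos_holds (W₀.baseChange ℚ)
  have hN1 : 1 ≤ N := le_trans (le_max_right _ _) hN₀le
  have hN0 : 0 < N := by linarith
  have hM0 : 0 ≤ M := by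
    rw [hMdef]; exact_mod_cast (abs_nonneg _).trans (le_max_left _ _)
  have hMσ' : N ^ σ' ≤ M := hviol.le
  have hMσ : N ^ σ ≤ M := le_trans (Real.rpow_le_rpow_of_exponent_le hN1 hσσ'.le) hMσ'
  set Y : ℝ := (M / N ^ κ) ^ (1 / (2 * κ - 6)) with hY
  set Y₁ : ℝ := (M / N ^ σ) ^ (1 / (2 * σ - 6)) with hY₁
  -- `Y` is large
  have hNθ : max a 1 ≤ N ^ θ := by
    have h1 : (max a 1) ^ (1 / θ) ≤ N :=
      le_trans (le_trans (le_max_left _ _) (le_max_left _ _)) hN₀le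
    calc max a 1 = ((max a 1) ^ (1 / θ)) ^ θ := by
          rw [one_div, Real.rpow_inv_rpow (by positivity) hθ0.ne']
      _ ≤ N ^ θ := Real.rpow_le_rpow (by positivity) h1 hθ0.le
  have hYge : N ^ θ ≤ Y := TwistAmplificationLemma.rpow_le_upper hκ hN1 hMσ'
  have haY : a ≤ Y := le_trans (le_trans (le_max_left _ _) hNθ) hYge
  obtain ⟨hcountlt, hYY₀⟩ := ha Y haY
  have hY64 : 64 ≤ Y := hY₀64.trans hYY₀
  have hY1 : 1 ≤ Y := by linarith
  have hYpos : 0 < Y := by linarith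
  -- the twist range is wide: `8 Y₁ ≤ Y`
  have h8 : (8 : ℝ) ≤ N ^ ((σ - κ) / (2 * κ - 6)) := by
    have h1 : (8 : ℝ) ^ ((2 * κ - 6) / (σ - κ)) ≤ N :=
      le_trans (le_trans (le_max_right _ _) (le_max_left _ _)) hN₀le
    have hσκ : (0 : ℝ) < σ - κ := by linarith
    calc (8 : ℝ) = ((8 : ℝ) ^ ((2 * κ - 6) / (σ - κ))) ^ ((σ - κ) / (2 * κ - 6)) := by
          rw [← Real.rpow_mul (by norm_num),
            show (2 * κ - 6) / (σ - κ) * ((σ - κ) / (2 * κ - 6)) = 1 by field_simp, Real.rpow_one]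
      _ ≤ N ^ ((σ - κ) / (2 * κ - 6)) :=
          Real.rpow_le_rpow (by positivity) h1 (div_nonneg hσκ.le heκ.le)
  have hY₁0 : 0 ≤ Y₁ := Real.rpow_nonneg (div_nonneg hM0 (Real.rpow_pos_of_pos hN0 _).le) _
  have hsep : 8 * Y₁ ≤ Y :=
    le_trans (mul_le_mul_of_nonneg_right h8 hY₁0)
      (TwistAmplificationLemma.separation hκ hκσ hN1 hMσ)
  -- the conductor scale
  set X : ℝ := N * Y ^ 2 with hX
  have hX1 : 1 ≤ X := one_le_mul_of_one_le_of_one_le hN1 (one_le_pow₀ hY1)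
  have hXν : X ≤ Y ^ ν := TwistAmplificationLemma.scale_le_rpow_upper hκ hκσ' hN1 hMσ'
  have hNle : N ≤ Y ^ ((2 * κ - 6) / (σ' - κ)) :=
    TwistAmplificationLemma.base_le_rpow_upper hκ hκσ' hN1 hMσ'
  -- the primes in `(Y/8, Y]`
  set m₂ : ℕ := ⌊Y / 8⌋₊ with hm₂
  set n₂ : ℕ := ⌊Y⌋₊ with hn₂
  have hm₂n₂ : m₂ ≤ n₂ := Nat.floor_le_floor (by linarith)
  have hm₂lt : Y / 8 < (m₂ : ℝ) + 1 := Nat.lt_floor_add_one _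
  have hn₂le : (n₂ : ℝ) ≤ Y := Nat.floor_le hYpos.le
  set D : Finset ℕ := (Finset.Ioc m₂ n₂).filter Nat.Prime with hD
  have hDmem : ∀ q ∈ D, q.Prime ∧ m₂ + 1 ≤ q ∧ q ≤ n₂ := by
    intro q hq
    simp only [hD, Finset.mem_filter, Finset.mem_Ioc] at hq
    exact ⟨hq.2, hq.1.1, hq.1.2⟩
  set good : Finset ℕ := D.filter (fun q ↦ ¬ q ∣ Nn) with hgood
  set bad : Finset ℕ := D.filter (fun q ↦ q ∣ Nn) with hbad
  -- few twisting primes divide `N`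
  have hbadlt : bad.card < E := by
    refine card_filter_dvd_lt (fun q hq ↦ ⟨(hDmem q hq).1, (hDmem q hq).2.1⟩) hNnpos ?_
    have h1 : (Nn : ℝ) ≤ (Y / 8) ^ E :=
      hNle.trans (TwistAmplificationLemma.rpow_le_div_eight_pow hY64 hE2)
    have h2 : (Y / 8) ^ E < ((m₂ : ℝ) + 1) ^ E := pow_lt_pow_left₀ hm₂lt (by positivity) (by omega)
    have : (Nn : ℝ) < (((m₂ + 1) ^ E : ℕ) : ℝ) := by push_cast; linarith
    exact_mod_cast this
  -- many primes in the range
  have hDcard : Y / (8 * Real.log Y) ≤ (D.card : ℝ) := by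
    rw [hD, card_primes_Ioc hm₂n₂, Nat.cast_sub (Nat.monotone_primeCounting hm₂n₂)]
    exact hsupply Y hYY₀
  have hsplit : good.card + bad.card = D.card := by
    rw [hgood, hbad, add_comm]
    exact Finset.card_filter_add_card_filter_not _
  -- each good prime gives a reduced minimal model in the window, with conductor `N q²`
  have hmem : ∀ q ∈ good, ∃ W₂ ∈ windowSet κ σ X,
      (W₂.baseChange ℚ).conductorNorm ℤ = Nn * q ^ 2 := by
    intro q hq
    rw [hgood, Finset.mem_filter] at hq
    obtain ⟨hqD, hqN⟩ := hq
    obtain ⟨hqp, hqm, hqn⟩ := hDmem q hqD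
    have hqm' : (m₂ : ℝ) + 1 ≤ q := by exact_mod_cast hqm
    have hq8 : Y / 8 < q := hm₂lt.trans_le hqm'
    have hq5 : 5 ≤ q := by
      have : (8 : ℝ) < q := by linarith
      have : 8 < q := by exact_mod_cast this
      omega
    have hqY : (q : ℝ) ≤ Y := le_trans (by exact_mod_cast hqn) hn₂le
    have hqpos : (0 : ℝ) < q := by exact_mod_cast hqp.pos
    refine TwistAmplificationLemma.exists_twist_mem_windowSet hQ hκ hσ3 hEl hmin hc₄ hc₆ hqp hq5
      hqN ?_ hqY ?_
    · exact mul_le_mul_of_nonneg_left (pow_le_pow_left₀ hqpos.le hqY 2) hN0.le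
    · linarith
  choose! f hf hf' using hmem
  have hinj : Set.InjOn f (good : Set ℕ) := by
    intro q hq q' hq' hff
    have h1 := hf' q hq
    have h2 := hf' q' hq'
    rw [hff] at h1
    rw [h1] at h2
    have : q ^ 2 = q' ^ 2 := Nat.eq_of_mul_eq_mul_left hNnpos h2
    exact Nat.pow_left_injective two_ne_zero this
  have hsub : ((good.image f : Finset (WeierstrassCurve ℤ)) : Set (WeierstrassCurve ℤ)) ⊆
      windowSet κ σ X := by
    intro W hW
    rw [Finset.coe_image] at hW
    obtain ⟨q, hq, rfl⟩ := hW
    exact hf q hq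
  have hgoodle : (good.card : ℝ) ≤ C * X ^ δ := by
    have h1 : good.card ≤ (windowSet κ σ X).ncard := by
      calc good.card = (good.image f).card := (Finset.card_image_of_injOn hinj).symm
        _ = ((good.image f : Finset (WeierstrassCurve ℤ)) : Set (WeierstrassCurve ℤ)).ncard :=
            (Set.ncard_coe_finset _).symm
        _ ≤ (windowSet κ σ X).ncard := Set.ncard_le_ncard hsub (windowSet_finite κ σ X)
    calc (good.card : ℝ) ≤ ((windowSet κ σ X).ncard : ℝ) := by exact_mod_cast h1
      _ ≤ C * X ^ δ := hcount X hX1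
  -- the hypothesised saving, transported to `Y`
  have hup : C * X ^ δ ≤ Cp * Y ^ lam := by
    have hX0 : 0 ≤ X := by linarith
    have hXδ0 : 0 ≤ X ^ δ := Real.rpow_nonneg hX0 _
    calc C * X ^ δ ≤ Cp * X ^ δ := mul_le_mul_of_nonneg_right (le_max_left _ _) hXδ0
      _ ≤ Cp * X ^ (max δ 0) :=
          mul_le_mul_of_nonneg_left (Real.rpow_le_rpow_of_exponent_le hX1 (le_max_left _ _))
            (le_max_right _ _)
      _ ≤ Cp * (Y ^ ν) ^ (max δ 0) :=
          mul_le_mul_of_nonneg_left (Real.rpow_le_rpow hX0 hXν (le_max_right _ _))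
            (le_max_right _ _)
      _ = Cp * Y ^ lam := by rw [hlam, ← Real.rpow_mul hYpos.le, mul_comm ν]
  -- contradiction
  have hlogY : 0 < Real.log Y := Real.log_pos (by linarith)
  have hfinal : (E : ℝ) + Cp * Y ^ lam < Y / (8 * Real.log Y) := by
    rw [lt_div_iff₀ (by positivity)]; exact hcountlt
  have hDlt : (D.card : ℝ) < good.card + E := by
    have : D.card < good.card + E := by omega
    exact_mod_cast this
  linarith [hDcard, hgoodle, hup]

end Summit.ABC.ABC.Theorems
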